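import Literature.NumberTheory.Automorphic.BCDTTheoremB
import Literature.NumberTheory.GaloisRepresentations.GL2F5OrderThree
import Literature.NumberTheory.GaloisRepresentations.HerbrandFunction
import HarnessLib

/-!
# BCDT Theorem 2.2.1, cases 2–6: the shape of `ρ̄` at `3` in the wild case (first reduction)

Topic `NumberTheory/Automorphic`; a theorems-only companion (no definitions, no named facts) of
`Literature.NumberTheory.Automorphic.BCDTTheoremB`, landed by the tenured seat of the named fact
`Literature.NumberTheory.Automorphic.BCDT.theoremB` (Breuil–Conrad–Diamond–Taylor 2001, Thm. B =
Thm. 2.2.1) as a bottom-up step INSIDE the one remaining opaque piece of its printed proof, the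
wild case `exists_isTorsionGaloisRep_and_isModular_of_not_isTamelyRamifiedAbove` (BCDT §2.2,
cases 2–6).

C. Breuil, B. Conrad, F. Diamond, R. Taylor, J. Amer. Math. Soc. 14 (2001) [BCDTJAMS2001], proof
of Theorem 2.2.1 (p. 860): *"Choose an element `τ ∈ GL₂(𝔽₅)` with `τ³ = 1` but `τ ≠ 1`. … Then up
to equivalence and twisting by a quadratic character, one of the following possibilities can be
attained. 1. `ρ̄` is tamely ramified at `3`. 2.–6. [`ρ̄|_{G₃}`, resp. `ρ̄|_{G_{ℚ₃(√-1)}}`,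
`ρ̄|_{G_{ℚ₃(√±3)}}`, is given by an explicit character into `𝔽₅(τ)^×`] … To see that one of these
cases can be attained, use the following facts … • A subgroup of `GL₂(𝔽₅)` with a non-trivial
normal subgroup of `3`-power order is, up to conjugation, contained in the normaliser of
`𝔽₅(τ)^×`. …"*  The subgroup in question is `ρ̄(G₃)`, the image of a decomposition group at `3`,
and its normal subgroup of `3`-power order is the image of wild inertia `P₃` (a pro-`3` group),
which is non-trivial precisely when `ρ̄` is NOT tamely ramified at `3` (cases 2–6).  This file
proves that first reduction for the tree's objects:

* `absUpperRamificationSubgroup_conj_mem_of_mem_decompositionSubgroup` — the absolute upper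
  ramification groups `Γ_K^u(𝔓)` are normalised by the decomposition group `D_𝔓` (Serre, *Corps
  locaux* IV §3 with IV §1 Prop. 1; plumbing over the tree's finite-level
  `Ideal.ramificationSubgroup_conj_mem`);
* `isPGroup_map_absUpperRamificationSubgroup` — for `u > 0` and `𝔓 ∣ v ∣ p`, the image of
  `Γ_K^u(𝔓)` under any continuous homomorphism to a discrete group is a `p`-group (every element
  has `p`-power order: the tree's `exists_pow_prime_pow_smul_eq_self`, Serre IV §2 Cor. 3);
* **`exists_conj_of_not_isTamelyRamifiedAbove_three`** — BCDT's first reduction: if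
  `ρ̄ : Γ_ℚ → GL₂(𝔽₅)` is not tamely ramified above `3` then at some prime `𝔓 ∣ 3` of `ℚ̄`, after
  conjugating `ρ̄` by some `x ∈ GL₂(𝔽₅)`, the decomposition group `D_𝔓` maps into the normaliser
  of `𝔽₅(τ)^×` (`GL2F5OrderThree.unitsF5Tau`, the centraliser of `τ = (0 -1; 1 -1)`), every wild
  ramification group `Γ_ℚ^u(𝔓)`, `u > 0`, maps into `⟨τ⟩`, and some `Γ_ℚ^u(𝔓)`, `u > 0`, maps ONTO
  `⟨τ⟩` — i.e. "`ρ̄(P₃) = ⟨τ⟩` and `ρ̄(G₃) ≤ N(𝔽₅(τ)^×)` up to conjugation", the common shape of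
  cases 2–6 (the image lies in the non-split Cartan `𝔽₅(τ)^×` or in its normaliser with index `2`,
  the quadratic subfield being `ℚ₃(√-1)`, `ℚ₃(√3)` or `ℚ₃(√-3)`; pinning down the characters is
  local class field theory and is not done here);
* `exists_conj_index_two_of_not_isTamelyRamifiedAbove_three` — the same with the split "case 2 /
  cases 3–6" spelled out: `ρ̄ˣ(D_𝔓) ⊆ 𝔽₅(τ)^× ∪ σ𝔽₅(τ)^×` and the elements of `D_𝔓` mapping into
  `𝔽₅(τ)^×` form a subgroup of index `≤ 2` (`GL2F5OrderThree`, appendix: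
  `N(𝔽₅(τ)^×) = 𝔽₅(τ)^× ∪ σ𝔽₅(τ)^×`).

## Proof of the reduction

Unfolding `FramedGaloisRep.IsTamelyRamifiedAbove` gives `v ∣ 3`, `𝔓 ∣ v`, `u₀ > 0` and
`σ₀ ∈ Γ^{u₀}(𝔓)` with `ρ̄(σ₀) ≠ 1`.  Inside `D = D_𝔓` the subgroup `Γ^{u₀}(𝔓)` is normal
(`Γ^{u₀} ≤ I_𝔓 ≤ D_𝔓` by the tree's `absUpperRamificationSubgroup_le_inertia_holds`), its image
is a non-trivial `3`-group, so `GL2F5OrderThree.exists_conj_apply_mem_normalizer_of_normal`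
conjugates `ρ̄|_D` into `N(𝔽₅(τ)^×)` with `ρ̄(Γ^{u₀}) = ⟨τ⟩`.  For another `u > 0` the image of
`Γ^u` is again a `3`-group, hence of order `≤ 3` (`GL2F5OrderThree.card_eq_three_of_isPGroup_three`),
and it contains or is contained in `⟨τ⟩` according as `u ≤ u₀` or `u ≥ u₀` (the filtration is
decreasing, `absUpperRamificationSubgroup_antitone_holds`); either way it lies in `⟨τ⟩`.

## References

* [BCDTJAMS2001] C. Breuil, B. Conrad, F. Diamond, R. Taylor, J. Amer. Math. Soc. 14 (2001),
  §2.2, proof of Thm. 2.2.1, p. 860 (cases 1–6 and the first bulleted fact).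
* [SerreLocalFields1979] J.-P. Serre, *Local Fields*, Ch. IV §1 Prop. 1, §2 Cor. 3, §3 Remark 1.

## Design

Pure theorems; `noncomputable section`; namespaces
`Literature.NumberTheory.GaloisRepresentations` (the two general ramification lemmas, next to
`absUpperRamificationSubgroup`) and `Literature.NumberTheory.Automorphic.BCDT` (the reduction);
no instances, no `sorry`, no named facts.  Axioms of every theorem: `propext`, `Classical.choice`,
`Quot.sound`.
-/

noncomputable section

open scoped NumberField Pointwise
open IsDedekindDomain

namespace Literature.NumberTheory.GaloisRepresentations

open Field

/-! ## Two general facts about the absolute upper ramification groups -/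

/-- **`Γ_K^v(𝔓)` is normalised by the decomposition group `D_𝔓`**: for `σ ∈ Γ_K^v(𝔓)` and `τ`
with `τ • 𝔓 = 𝔓`, `τ σ τ⁻¹ ∈ Γ_K^v(𝔓)` (at each finite normal level `E`, `τ|_E` stabilises
`𝔓 ∩ E` and `Gal(E/K)^v = G_{⌈ψ v⌉}` is normal in the decomposition group, Serre IV §1 Prop. 1).
[cite: SerreLocalFields1979, Ch. IV §1 Prop. 1 and §3 Remark 1] -/
theorem absUpperRamificationSubgroup_conj_mem_of_mem_decompositionSubgroup
    {R : Type*} {K : Type*} [CommRing R] [Field K] [Algebra R K]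
    {𝔓 : Ideal (absIntegers R K)} {v : ℝ} {σ τ : absoluteGaloisGroup K}
    (hσ : σ ∈ absUpperRamificationSubgroup R 𝔓 v)
    (hτ : τ ∈ 𝔓.decompositionSubgroup (absoluteGaloisGroup K)) :
    τ * σ * τ⁻¹ ∈ absUpperRamificationSubgroup R 𝔓 v := by
  rw [mem_absUpperRamificationSubgroup_iff] at hσ ⊢
  intro E _ _
  rw [map_mul, map_mul, map_inv]
  refine Ideal.ramificationSubgroup_conj_mem _ _ (hσ E) ?_
  rw [Ideal.mem_decompositionSubgroup_iff] at hτ ⊢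
  ext x
  rw [Ideal.mem_pointwise_smul_iff_inv_smul_mem, Ideal.mem_comap, Ideal.mem_comap, ← map_inv]
  have hsmul : E.integralClosureToAbsIntegers R (absRestrictNormalHom E τ⁻¹ • x) =
      τ⁻¹ • E.integralClosureToAbsIntegers R x :=
    E.integralClosureToAbsIntegers_restrictNormalHom_smul R τ⁻¹ x
  rw [hsmul, ← Ideal.mem_pointwise_smul_iff_inv_smul_mem, hτ]

/-- **The image of a wild ramification group in a discrete group is a `p`-group**: for `u > 0`,
`𝔓 ∣ v ∣ p` and a continuous homomorphism `f : Γ_K → H` to a discrete group, every element of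
`f(Γ_K^u(𝔓))` has `p`-power order (the tree's `exists_pow_prime_pow_smul_eq_self`, applied to `Γ_K`
acting on `H` through `f`: `Γ_K^u ↠ Gal(E/K)^u ≤ G₁`, a `p`-group, Serre IV §2 Cor. 3).
[cite: SerreLocalFields1979, Ch. IV §2 Cor. 3 of Prop. 7] -/
theorem isPGroup_map_absUpperRamificationSubgroup {K : Type*} [Field K] [NumberField K]
    {v : HeightOneSpectrum (𝓞 K)} {𝔓 : Ideal (absIntegers (𝓞 K) K)} (h𝔓 : 𝔓 ∈ v.primesAbove)
    {p : ℕ} (hpv : (p : 𝓞 K) ∈ v.asIdeal) {u : ℝ} (hu : 0 < u)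
    {H : Type*} [Group H] [TopologicalSpace H] [DiscreteTopology H]
    (f : absoluteGaloisGroup K →ₜ* H) :
    IsPGroup p ((absUpperRamificationSubgroup (𝓞 K) 𝔓 u).map f.toMonoidHom) := by
  rintro ⟨_, σ, hσ, rfl⟩
  letI : MulAction (absoluteGaloisGroup K) H := MulAction.compHom H f.toMonoidHom
  have hopen : IsOpen {τ : absoluteGaloisGroup K | ∀ x : H, τ • x = x} := by
    have hset : {τ : absoluteGaloisGroup K | ∀ x : H, τ • x = x} = f ⁻¹' {1} := by
      ext τ
      simp only [Set.mem_setOf_eq, Set.mem_preimage, Set.mem_singleton_iff,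
        MulAction.compHom_smul_def, smul_eq_mul]
      constructor
      · intro h
        simpa using h 1
      · intro h x
        change f τ * x = x
        rw [h, one_mul]
    rw [hset]
    exact (isOpen_discrete _).preimage f.continuous
  obtain ⟨k, hk⟩ :=
    Automorphic.BCDT.exists_pow_prime_pow_smul_eq_self h𝔓 hpv hu hσ H hopen
  refine ⟨k, Subtype.ext ?_⟩
  rw [Subgroup.coe_pow, Subgroup.coe_one]
  have h1 := hk 1
  rwa [MulAction.compHom_smul_def, smul_eq_mul, mul_one, map_pow] at h1

end Literature.NumberTheory.GaloisRepresentations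

namespace Literature.NumberTheory.Automorphic.BCDT

open Field GaloisRepresentations GaloisRepresentations.GL2F5OrderThree

/-! ## BCDT §2.2, cases 2–6: the first reduction -/

/-- **BCDT, proof of Theorem 2.2.1, the wild case (cases 2–6), first reduction** (p. 860: *"A
subgroup of `GL₂(𝔽₅)` with a non-trivial normal subgroup of `3`-power order is, up to
conjugation, contained in the normaliser of `𝔽₅(τ)^×`"*, applied to `ρ̄(G₃) ⊵ ρ̄(P₃)`).  If
`ρ̄ : Γ_ℚ → GL₂(𝔽₅)` is NOT tamely ramified above `3`
(`FramedGaloisRep.IsTamelyRamifiedAbove`), then there are a place `v ∣ 3`, a prime `𝔓 ∣ v` of `ℚ̄`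
and `x ∈ GL₂(𝔽₅)` such that, writing `ρ̄ˣ = x ρ̄ x⁻¹`:
* `ρ̄ˣ(D_𝔓) ≤ N(𝔽₅(τ)^×)` — the decomposition group maps into the normaliser of the non-split
  Cartan subgroup `𝔽₅(τ)^× = C(τ)`, `τ = (0 -1; 1 -1)`;
* `ρ̄ˣ(Γ_ℚ^u(𝔓)) ≤ ⟨τ⟩` for every `u > 0` — wild inertia maps into the group of order `3`
  generated by `τ`;
* `ρ̄ˣ(Γ_ℚ^u(𝔓)) = ⟨τ⟩` for some `u > 0` — and onto it.
[cite: BCDTJAMS2001, §2.2 (proof of Thm. 2.2.1, p. 860: cases 2–6 and first bullet)] -/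
theorem exists_conj_of_not_isTamelyRamifiedAbove_three (ρ : ModPGaloisRep ℚ (ZMod 5) 2)
    (hwild : ¬ ρ.IsTamelyRamifiedAbove 3) :
    ∃ v : HeightOneSpectrum (𝓞 ℚ), ((3 : ℕ) : 𝓞 ℚ) ∈ v.asIdeal ∧ ∃ 𝔓 ∈ v.primesAbove,
      ∃ x : GL (Fin 2) (ZMod 5),
        (∀ σ ∈ 𝔓.decompositionSubgroup (absoluteGaloisGroup ℚ),
            x * ρ σ * x⁻¹ ∈ Subgroup.normalizer (unitsF5Tau : Set (GL (Fin 2) (ZMod 5)))) ∧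
        (∀ u : ℝ, 0 < u → ∀ σ ∈ absUpperRamificationSubgroup (𝓞 ℚ) 𝔓 u,
            x * ρ σ * x⁻¹ ∈ Subgroup.zpowers tau) ∧
        ∃ u : ℝ, 0 < u ∧
          (absUpperRamificationSubgroup (𝓞 ℚ) 𝔓 u).map
              ((MulAut.conj x).toMonoidHom.comp ρ.toMonoidHom) = Subgroup.zpowers tau := by
  classical
  -- unfold "not tamely ramified above 3"
  simp only [FramedGaloisRep.IsTamelyRamifiedAbove, not_forall, exists_prop] at hwild
  obtain ⟨v, hv, 𝔓, h𝔓, u₀, hu₀, σ₀, hσ₀, hne⟩ := hwild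
  refine ⟨v, hv, 𝔓, h𝔓, ?_⟩
  -- notation
  set Γu : ℝ → Subgroup (absoluteGaloisGroup ℚ) := fun u ↦ absUpperRamificationSubgroup (𝓞 ℚ) 𝔓 u
    with hΓu
  set D : Subgroup (absoluteGaloisGroup ℚ) := 𝔓.decompositionSubgroup (absoluteGaloisGroup ℚ) with hD
  have hle : ∀ u, Γu u ≤ D := fun u ↦
    (absUpperRamificationSubgroup_le_inertia_holds (𝓞 ℚ) 𝔓 u (K := ℚ)).trans
      (Ideal.inertia_le_decompositionSubgroup _ _)
  -- `Γ^{u₀}` as a normal subgroup of `D`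
  set P : Subgroup D := (Γu u₀).subgroupOf D with hP
  haveI hPn : P.Normal :=
    (Subgroup.normal_subgroupOf_iff (hle u₀)).mpr fun h k hh hk ↦
      absUpperRamificationSubgroup_conj_mem_of_mem_decompositionSubgroup hh hk
  set ρD : D →* GL (Fin 2) (ZMod 5) := ρ.toMonoidHom.comp D.subtype with hρD
  have hPmap : P.map ρD = (Γu u₀).map ρ.toMonoidHom := by
    rw [hρD, ← Subgroup.map_map, hP, Subgroup.subgroupOf_map_subtype, inf_eq_left.mpr (hle u₀)]
  -- its image is a non-trivial `3`-group
  have h3 : ∀ u, 0 < u → IsPGroup 3 ((Γu u).map ρ.toMonoidHom) := fun u hu ↦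
    isPGroup_map_absUpperRamificationSubgroup h𝔓 hv hu ρ
  have hP3 : IsPGroup 3 (P.map ρD) := hPmap ▸ h3 u₀ hu₀
  have hP1 : P.map ρD ≠ ⊥ := by
    rw [hPmap]
    intro hbot
    apply hne
    have : ρ.toMonoidHom σ₀ ∈ (Γu u₀).map ρ.toMonoidHom := ⟨σ₀, hσ₀, rfl⟩
    rw [hbot, Subgroup.mem_bot] at this
    exact this
  -- BCDT's first fact
  obtain ⟨x, hN, hPx⟩ := exists_conj_apply_mem_normalizer_of_normal ρD P hP3 hP1
  have hontou₀ : (Γu u₀).map ((MulAut.conj x).toMonoidHom.comp ρ.toMonoidHom) =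
      Subgroup.zpowers tau := by
    rw [← hPx, hρD, hP, ← MonoidHom.comp_assoc, ← Subgroup.map_map (K := (Γu u₀).subgroupOf D),
      Subgroup.subgroupOf_map_subtype, inf_eq_left.mpr (hle u₀)]
  refine ⟨x, fun σ hσ ↦ hN ⟨σ, hσ⟩, ?_, u₀, hu₀, hontou₀⟩
  -- every `Γ^u`, `u > 0`, maps into `⟨τ⟩`
  intro u hu σ hσ
  have hmem : x * ρ σ * x⁻¹ ∈ (Γu u).map ((MulAut.conj x).toMonoidHom.comp ρ.toMonoidHom) :=
    ⟨σ, hσ, rfl⟩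
  have hQ3 : IsPGroup 3 ((Γu u).map ((MulAut.conj x).toMonoidHom.comp ρ.toMonoidHom)) := by
    rw [← Subgroup.map_map]
    exact (h3 u hu).map _
  rcases le_total u u₀ with huu | huu
  · -- `Γ^{u₀} ≤ Γ^u`: the image of `Γ^u` is a `3`-group containing `⟨τ⟩`, hence equal to it
    have hsub : Subgroup.zpowers tau ≤
        (Γu u).map ((MulAut.conj x).toMonoidHom.comp ρ.toMonoidHom) := by
      rw [← hontou₀]
      exact Subgroup.map_mono (absUpperRamificationSubgroup_antitone_holds (𝓞 ℚ) 𝔓 huu)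
    have hne' : (Γu u).map ((MulAut.conj x).toMonoidHom.comp ρ.toMonoidHom) ≠ ⊥ := by
      intro hbot
      rw [hbot, le_bot_iff, Subgroup.zpowers_eq_bot] at hsub
      exact tau_ne_one hsub
    have hcard := card_eq_three_of_isPGroup_three hQ3 hne'
    have hz : Nat.card (Subgroup.zpowers tau) = 3 := by rw [Nat.card_zpowers, orderOf_tau]
    rw [Subgroup.eq_of_le_of_card_ge hsub (hcard.trans hz.symm).le]
    exact hmem
  · -- `Γ^u ≤ Γ^{u₀}`
    rw [← hontou₀]
    exact Subgroup.map_mono (absUpperRamificationSubgroup_antitone_holds (𝓞 ℚ) 𝔓 huu) hmem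

/-- **BCDT, proof of Theorem 2.2.1, cases 2–6: the split "case 2 / cases 3–6"** (p. 860).  With
`v, 𝔓, x` as in `exists_conj_of_not_isTamelyRamifiedAbove_three` and `ρ̄ˣ = x ρ̄ x⁻¹`, put
`H = {σ | ρ̄ˣ(σ) ∈ 𝔽₅(τ)^×}` (the preimage of the non-split Cartan `unitsF5Tau`).  Then every wild
ramification group `Γ_ℚ^u(𝔓)`, `u > 0`, lies in `H`, and `D_𝔓 ∩ H` has index at most `2` in `D_𝔓`:
each `σ ∈ D_𝔓` has `ρ̄ˣ(σ) ∈ 𝔽₅(τ)^×` or `ρ̄ˣ(σ) ∈ σ₀𝔽₅(τ)^×` (`σ₀ = GL2F5OrderThree.sigma`), and the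
product of two elements of `D_𝔓 \ H` lies in `H`.  So either `ρ̄ˣ(D_𝔓) ≤ 𝔽₅(τ)^×` (BCDT's case 2:
"`ρ̄|_{G₃}` is given by a character `ℚ₃^× → 𝔽₅(τ)^×`") or `D_𝔓 ∩ H` is the index-`2` subgroup
`G_M ≤ G₃` of a quadratic `M/ℚ₃` on which `ρ̄ˣ` is a character into `𝔽₅(τ)^×` (cases 3–6; that
`M ∈ {ℚ₃(√-1), ℚ₃(√3), ℚ₃(√-3)}` and the values of the characters are local class field theory,
not formalised here).
[cite: BCDTJAMS2001, §2.2 (proof of Thm. 2.2.1, p. 860, cases 2–6)] -/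
theorem exists_conj_index_two_of_not_isTamelyRamifiedAbove_three (ρ : ModPGaloisRep ℚ (ZMod 5) 2)
    (hwild : ¬ ρ.IsTamelyRamifiedAbove 3) :
    ∃ v : HeightOneSpectrum (𝓞 ℚ), ((3 : ℕ) : 𝓞 ℚ) ∈ v.asIdeal ∧ ∃ 𝔓 ∈ v.primesAbove,
      ∃ x : GL (Fin 2) (ZMod 5),
        (∀ σ ∈ 𝔓.decompositionSubgroup (absoluteGaloisGroup ℚ),
            x * ρ σ * x⁻¹ ∈ unitsF5Tau ∨ sigma⁻¹ * (x * ρ σ * x⁻¹) ∈ unitsF5Tau) ∧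
        (∀ σ ∈ 𝔓.decompositionSubgroup (absoluteGaloisGroup ℚ),
          ∀ σ' ∈ 𝔓.decompositionSubgroup (absoluteGaloisGroup ℚ),
            x * ρ σ * x⁻¹ ∉ unitsF5Tau → x * ρ σ' * x⁻¹ ∉ unitsF5Tau →
              x * ρ (σ * σ') * x⁻¹ ∈ unitsF5Tau) ∧
        (∀ u : ℝ, 0 < u → ∀ σ ∈ absUpperRamificationSubgroup (𝓞 ℚ) 𝔓 u,
            x * ρ σ * x⁻¹ ∈ Subgroup.zpowers tau) ∧
        ∃ u : ℝ, 0 < u ∧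
          (absUpperRamificationSubgroup (𝓞 ℚ) 𝔓 u).map
              ((MulAut.conj x).toMonoidHom.comp ρ.toMonoidHom) = Subgroup.zpowers tau := by
  obtain ⟨v, hv, 𝔓, h𝔓, x, hN, hwildle, hu⟩ := exists_conj_of_not_isTamelyRamifiedAbove_three ρ hwild
  refine ⟨v, hv, 𝔓, h𝔓, x, fun σ hσ ↦ mem_or_sigma_inv_mul_mem_of_mem_normalizer_unitsF5Tau (hN σ hσ),
    fun σ hσ σ' hσ' h h' ↦ ?_, hwildle, hu⟩
  have e : x * ρ (σ * σ') * x⁻¹ = x * ρ σ * x⁻¹ * (x * ρ σ' * x⁻¹) := by rw [map_mul]; group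
  rw [e]
  exact mul_mem_unitsF5Tau_of_not_mem_of_not_mem (hN σ hσ) (hN σ' hσ') h h'

end Literature.NumberTheory.Automorphic.BCDT

end
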